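import Summits.ResolutionOfSingularities.ResolutionOfSingularities.Theorems.EquisingularLiftEquisingularLiftNatTowerConeRound
import Summits.ResolutionOfSingularities.ResolutionOfSingularities.Theorems.EquisingularLiftEquisingularLiftNatTowerRuledDefs
import Summits.ResolutionOfSingularities.ResolutionOfSingularities.Theorems.EquisingularLiftEquisingularLiftNatTransportedCentre
import Summits.ResolutionOfSingularities.ResolutionOfSingularities.Theorems.EquisingularLiftEquisingularLiftNatRationalCarrierTransport
import Summits.ResolutionOfSingularities.ResolutionOfSingularities.Theorems.EquisingularLiftEquisingularLiftNatCarrierPairStrictTransformRegular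
import Literature.AlgebraicGeometry.Resolution.AlterationsBoundaryDivisor
import HarnessLib

/-!
# [OURS · L1 W4.5(b) · EL♮(3)] HSUB′(ReachTower₃) — S6 (d)→(N1): THE ČECH CENTRE AT THE STAGE FROM A CENTRE AT THE ROOT OF `DirLift.Ruled`
# (the stand-in (N1) `hCentre` of …NatTowerCechRound / …Old / …Closer REDUCED to the root-level stand-in (N1°) `hRootCentre`, over
# res-L1-w45b-stub-2's `…NatTransportedCentre` and res-L1-type-o6's `…NatRationalCarrierTransport`)

res-D-pv-057 g9 AS a w45b hand (S6 `hCech`; stub-2's decomposition note 20:25:39Z (a)–(d)). OURS; NOT a statement of any manuscript; AI-written, weaker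
than expert review. No `sorry`; standard axioms. DEF-FREE. `--supports stmt-ResolutionOfSingularities-20148 --as helper`. Pattern (E).

WHAT. `Tower.hCentre_of_root`: the (N1) text of `Tower.hCech_of` (∀ Čech-witnessed stage, ∃ `𝒦₁` with (c1)–(c6) for `𝒞 = 𝓔 ⊔ 𝒦₁`) FOLLOWS from the
ROOT-LEVEL stand-in **(N1°) `hRootCentre`**: after unpacking `DirLift.Ruled` (root `X₀ ⊇ V(I)`, `τ₀ : X₁ → X₀` its blow-up, `ρ : X ⟶ X₁`,
`e : V(𝓔) ≅ V(I·𝒪_{X₁})` over `ρ`, root model squares `j₀, j₁`, `ϱ : G ⟶ G₁`), SOME ideal `C₁ ⊇ I·𝒪_{X₁}` on `X₁` with `V(C₁)` regular,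
`O`-flat, `C₁|_{V(I·𝒪_{X₁})}` effective Cartier, exact reduced trace `C₁·𝒪_{G₁} = 𝓘⟨Γ₁⟩` with `E ∩ ϱ⁻¹Γ₁ = Z` (the section pushed to the root), and
`V(C₁) ≅ ℙ¹_O` when the carrier is certified rational — i.e. EXACTLY the centre block of `directionRoundStep` (p556868) at the root, `C₁ := controlledTransform
τ₀ I 𝒟 1` for the lifted direction `𝒟` (T-DIRLIFT-UP, res-D-pv-051) of the pushed section (bridge p567357 + DIRDICT (a) p559974), with stub-2's announced
`isEffectiveCartier_directionCentre_comap_exceptional` for the Cartier clause. Then `𝒦₁ := C₁·𝒪_X`: (c1) `transportedCentre_comap_eq_vanishingIdeal`,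
(c2) `flat_transportedCentre`, (c3) `isRegular_transportedCentre`, (c4) `isEffectiveCartier_transportedCentre_comap` (read on `𝒦₁`), (c5)
`exists_twoFrame_transportedCentre` (its `IsEffectiveCartier 𝓔` from (e-ii)/(e-i): `X` integral, `𝓔 ≠ 0` since `E ≠ G`), (c6) `hCrat_of_iso_over` along
`exists_iso_subscheme_transportedCentre`.
-/

set_option linter.dupNamespace false -- mandated namespace `Summit.<Summit>.<Problem>` of this single-conjunct summit
set_option linter.overlappingInstances false -- signatures carry `[IsDomain O] [IsDiscreteValuationRing O]`

noncomputable section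

open CategoryTheory CategoryTheory.Limits AlgebraicGeometry TopologicalSpace Topology IsLocalRing
open Literature.AlgebraicGeometry.Resolution
open Literature.AlgebraicGeometry.Morphisms (ProjCech.PP ProjCech.toSpec)
open AlgebraicGeometry.Scheme.IdealSheafData
open Summit.ResolutionOfSingularities.ResolutionOfSingularities.Theses.EquisingularLift.Split
open Summit.ResolutionOfSingularities.ResolutionOfSingularities.Cruxes.EquisingularLift.StrataSplit

namespace Summit.ResolutionOfSingularities.ResolutionOfSingularities.Cruxes.EquisingularLiftNat.Sections

set_option maxHeartbeats 1600000 in -- long binder texts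
/-- **(N1) from (N1°)**: the stage-level Čech centre of `Tower.hCech_of` from a centre at the ROOT of `DirLift.Ruled` (see the module docstring).
[cite: GortzWedhorn2020, Prop. 4.20 and (13.19)] [cite: Matsumura1987, Thm. 16.2 (i)] [OURS · L1 W4.5b · S6 (d)] toward `stub_elnat_coneTowerPointResolution`
(stmt-ResolutionOfSingularities-20148 / -20038); NOT a statement of the manuscript. -/
theorem Tower.hCentre_of_root (O : Type) [CommRing O] [IsDomain O] [IsDiscreteValuationRing O] (k : Type) [Field k]
    (θ : O →+* k) (hθ : Function.Surjective θ) (P : Scheme.{0}) (q : P ⟶ Spec (.of O)) (Y : Set P)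
    (Ch : ∀ X' : Scheme.{0}, (X' ⟶ P) → Set X' → Prop)
    -- (N1°) STAND-IN: the centre at the ROOT (owner: the T-DIRLIFT chain — res-L1-w45b-stub-2 / res-D-pv-051 / res-L1-w45b-stub-3)
    (hRootCentre : ∀ {F₉ : Scheme.{0}} (Z₉ : Set F₉) (hZ₉ : IsClosed Z₉) {F₁₀ : Scheme.{0}} (υ' : F₁₀ ⟶ F₉)
        (G : Scheme.{0}) (γ : G ⟶ F₁₀) (E : Set G) (hE : IsClosed E) (Z : Set G) (hZ : IsClosed Z),
        DirStepSec F₉ F₁₀ υ' Z₉ hZ₉ G γ Z hZ → RationalCarrier (redSub F₉ Z₉ hZ₉) →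
        (∀ x : redSub G Z hZ, IsRegularLocalRing (G.presheaf.stalk (redSubι G Z hZ x))) →
        (∀ (i : redSub G Z hZ ⟶ redSub G E hE), i ≫ redSubι G E hE = redSubι G Z hZ →
          ∀ x : redSub G Z hZ, IsRegularLocalRing ((redSub G E hE).presheaf.stalk (i x))) →
        DirStepUnobs G E hE Z hZ → Z ⊆ E →
        -- the stage and its exceptional surface
        ∀ (X : Scheme.{0}) (σ : X ⟶ P) (jG : G ⟶ X) (tG : G ⟶ Spec (.of k)) (𝓔 : X.IdealSheafData),
        IsIntegral X → IsLocallyNoetherian X → Scheme.IsRegular X →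
        IsPullback jG tG (σ ≫ q) (Spec.map (CommRingCat.ofHom θ)) →
        𝓔.comap jG = vanishingIdeal ⟨E, hE⟩ → (∀ z : X, (stalkIdeal 𝓔 z).IsPrincipal) → Scheme.IsRegular 𝓔.subscheme →
        -- the root of `DirLift.Ruled` (R1)–(R4), unpacked
        ∀ (X₀ : Scheme.{0}) (σ₀ : X₀ ⟶ P) (I : X₀.IdealSheafData) (X₁ : Scheme.{0}) (τ₀ : X₁ ⟶ X₀) (ρ : X ⟶ X₁)
          (G₀ : Scheme.{0}) (j₀ : G₀ ⟶ X₀) (t₀ : G₀ ⟶ Spec (.of k)) (γ₀ : G₀ ⟶ F₉)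
          (G₁ : Scheme.{0}) (j₁ : G₁ ⟶ X₁) (t₁ : G₁ ⟶ Spec (.of k)) (υ₁ : G₁ ⟶ G₀) (ϱ : G ⟶ G₁)
          (e : 𝓔.subscheme ≅ (I.comap τ₀).subscheme) (Z₀ : Set G₀) (hZ₀ : IsClosed Z₀) (δ₀ : redSub G₀ Z₀ hZ₀ ⟶ redSub F₉ Z₉ hZ₉),
        IsIntegral X₀ → IsLocallyNoetherian X₀ → Scheme.IsRegular X₀ → IsBlowup τ₀ I → σ = (ρ ≫ τ₀) ≫ σ₀ →
        e.hom ≫ (I.comap τ₀).subschemeι = 𝓔.subschemeι ≫ ρ →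
        IsPullback j₀ t₀ (σ₀ ≫ q) (Spec.map (CommRingCat.ofHom θ)) → IsPullback j₁ t₁ ((τ₀ ≫ σ₀) ≫ q) (Spec.map (CommRingCat.ofHom θ)) →
        j₁ ≫ τ₀ = υ₁ ≫ j₀ → IsBlowup υ₁ (I.comap j₀) → jG ≫ ρ = ϱ ≫ j₁ → ϱ ≫ υ₁ ≫ γ₀ = γ ≫ υ' →
        I.comap j₀ = vanishingIdeal ⟨Z₀, hZ₀⟩ → δ₀ ≫ redSubι F₉ Z₉ hZ₉ = redSubι G₀ Z₀ hZ₀ ≫ γ₀ → IsIso δ₀ →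
        Scheme.IsRegular I.subscheme → Flat (I.subschemeι ≫ σ₀ ≫ q) → σ₀ '' (I.support : Set X₀) ⊆ {p : P | ¬ IsGenericPoint p Y} →
        (∀ x ∈ I.support, ∃ c : Fin 2 → X₀.presheaf.stalk x, Ideal.span (Set.range c) = stalkIdeal I x ∧ IsQuasiRegular c) →
        (RationalCarrier (redSub F₉ Z₉ hZ₉) → ∃ e₁ : I.subscheme ≅ ProjCech.PP O 1, e₁.hom ≫ ProjCech.toSpec O 1 = I.subschemeι ≫ σ₀ ≫ q) →
        ∃ (C₁ : X₁.IdealSheafData) (Γ₁ : Set G₁) (hΓ₁ : IsClosed Γ₁),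
          I.comap τ₀ ≤ C₁ ∧ Scheme.IsRegular C₁.subscheme ∧ Flat (C₁.subschemeι ≫ (τ₀ ≫ σ₀) ≫ q) ∧
          IsEffectiveCartier (C₁.comap (I.comap τ₀).subschemeι) ∧
          C₁.comap j₁ = vanishingIdeal ⟨Γ₁, hΓ₁⟩ ∧ E ∩ ϱ ⁻¹' Γ₁ = Z ∧
          (RationalCarrier (redSub F₉ Z₉ hZ₉) →
            ∃ e₁ : C₁.subscheme ≅ ProjCech.PP O 1, e₁.hom ≫ ProjCech.toSpec O 1 = C₁.subschemeι ≫ (τ₀ ≫ σ₀) ≫ q)) :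
    -- ======== the (N1) text of `Tower.hCech_of₂` (= (N1) of `Tower.hCech_of` with the round's data `Z ⊆ E ∩ T`, `Z ≠ ∅`, `TowerFull` added) ========
    ∀ {F₉ : Scheme.{0}} (Z₉ : Set F₉) (hZ₉ : IsClosed Z₉) {F₁₀ : Scheme.{0}} (υ' : F₁₀ ⟶ F₉)
        (G : Scheme.{0}) (γ : G ⟶ F₁₀) (T E : Set G) (hE : IsClosed E) (Z : Set G) (hZ : IsClosed Z),
        Z ⊆ E ∩ T → Z.Nonempty → TowerFull F₉ F₁₀ υ' Z₉ hZ₉ G γ Z hZ → ¬ T ⊆ E →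
        DirStepSec F₉ F₁₀ υ' Z₉ hZ₉ G γ Z hZ → RationalCarrier (redSub F₉ Z₉ hZ₉) →
        (∀ x : redSub G Z hZ, IsRegularLocalRing (G.presheaf.stalk (redSubι G Z hZ x))) →
        (∀ (i : redSub G Z hZ ⟶ redSub G E hE), i ≫ redSubι G E hE = redSubι G Z hZ →
          ∀ x : redSub G Z hZ, IsRegularLocalRing ((redSub G E hE).presheaf.stalk (i x))) →
        DirStepUnobs G E hE Z hZ →
        ∀ (X : Scheme.{0}) (σ : X ⟶ P) (S : Set X) (jG : G ⟶ X) (tG : G ⟶ Spec (.of k)) (𝓔 : X.IdealSheafData),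
        Ch X σ S → IsIntegral X → IsLocallyNoetherian X → Scheme.IsRegular X → IsDominant (σ ≫ q) →
        IsPullback jG tG (σ ≫ q) (Spec.map (CommRingCat.ofHom θ)) → jG '' T = S →
        𝓔.comap jG = vanishingIdeal ⟨E, hE⟩ → (∀ z : X, (stalkIdeal 𝓔 z).IsPrincipal) → Scheme.IsRegular 𝓔.subscheme →
        σ '' (𝓔.support : Set X) ⊆ {p : P | ¬ IsGenericPoint p Y} →
        DirLift.Ruled O k θ P q Y F₉ Z₉ hZ₉ F₁₀ υ' G γ E X σ jG 𝓔 →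
        ∃ 𝒦₁ : X.IdealSheafData,
          (𝓔 ⊔ 𝒦₁).comap jG = vanishingIdeal ⟨Z, hZ⟩ ∧ Flat ((𝓔 ⊔ 𝒦₁).subschemeι ≫ σ ≫ q) ∧
          Scheme.IsRegular (𝓔 ⊔ 𝒦₁).subscheme ∧ IsEffectiveCartier (𝒦₁.comap 𝓔.subschemeι) ∧
          (∀ x ∈ (𝓔 ⊔ 𝒦₁).support, ∃ c : Fin 2 → X.presheaf.stalk x,
            Ideal.span (Set.range c) = stalkIdeal (𝓔 ⊔ 𝒦₁) x ∧ IsQuasiRegular c) ∧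
          (RationalCarrier (redSub F₉ Z₉ hZ₉) →
            ∃ e₁ : (𝓔 ⊔ 𝒦₁).subscheme ≅ ProjCech.PP O 1, e₁.hom ≫ ProjCech.toSpec O 1 = (𝓔 ⊔ 𝒦₁).subschemeι ≫ σ ≫ q) := by
  intro F₉ Z₉ hZ₉ F₁₀ υ' G γ T E hE Z hZ hZET _ _ hTE hsec hrat hGreg hEreg hunobs X σ S jG tG 𝓔 _ hXint hXnoeth hXreg _ hsq _
    he_i he_ii he_iii _ hruled
  haveI := hXint
  haveI := hXnoeth
  have hZE : Z ⊆ E := fun z hz => (hZET hz).1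
  -- unpack the root of `DirLift.Ruled`
  obtain ⟨X₀, σ₀, I, X₁, τ₀, ρ, G₀, j₀, t₀, γ₀, G₁, j₁, t₁, υ₁, ϱ, hX₀int, hX₀noeth, hX₀reg, hτ₀, hσ, ⟨e, he⟩, hsq₀, hsq₁, hcomm₁, hυ₁,
    hjρ, hγ, ⟨Z₀, hZ₀, hIZ₀, δ₀, hδ₀, hδ₀iso⟩, hIreg, hIflat, hIoff, hIframe, hIrat⟩ := hruled
  -- (N1°) the centre at the root
  obtain ⟨C₁, Γ₁, hΓ₁, hEC, hC₁reg, hC₁flat, hC₁cart, hC₁tr, hZΓ, hC₁rat⟩ :=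
    hRootCentre Z₉ hZ₉ υ' G γ E hE Z hZ hsec hrat hGreg hEreg hunobs hZE X σ jG tG 𝓔 hXint hXnoeth hXreg hsq he_i he_ii he_iii
      X₀ σ₀ I X₁ τ₀ ρ G₀ j₀ t₀ γ₀ G₁ j₁ t₁ υ₁ ϱ e Z₀ hZ₀ δ₀ hX₀int hX₀noeth hX₀reg hτ₀ hσ he hsq₀ hsq₁ hcomm₁ hυ₁ hjρ hγ hIZ₀ hδ₀ hδ₀iso
      hIreg hIflat hIoff hIframe hIrat
  -- the cartesian square of special fibres `(jG, ϱ, ρ, j₁)`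
  have hsq' : IsPullback jG tG (ρ ≫ (τ₀ ≫ σ₀) ≫ q) (Spec.map (CommRingCat.ofHom θ)) := by
    have h := hsq
    rw [hσ] at h
    simpa only [Category.assoc] using h
  have hcart : IsPullback jG ϱ ρ j₁ := isPullback_of_model_squares θ hθ ((τ₀ ≫ σ₀) ≫ q) ρ j₁ t₁ hsq₁ jG tG hsq' ϱ hjρ
  refine ⟨C₁.comap ρ, ?_, ?_, ?_, ?_, ?_, ?_⟩
  · -- (c1) exact reduced trace
    have h := transportedCentre_comap_eq_vanishingIdeal ρ 𝓔 (I.comap τ₀) C₁ e hEC he jG j₁ ϱ hcart hE he_i hΓ₁ hC₁tr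
    rw [h]
    congr 1
    exact Closeds.ext hZΓ
  · -- (c2) flat over `O`
    have h := flat_transportedCentre ρ 𝓔 (I.comap τ₀) C₁ e hEC he ((τ₀ ≫ σ₀) ≫ q) hC₁flat
    have heq : (𝓔 ⊔ C₁.comap ρ).subschemeι ≫ σ ≫ q = (𝓔 ⊔ C₁.comap ρ).subschemeι ≫ ρ ≫ (τ₀ ≫ σ₀) ≫ q := by
      rw [hσ]; simp only [Category.assoc]
    rw [heq]; exact h
  · -- (c3) regular
    exact isRegular_transportedCentre ρ 𝓔 (I.comap τ₀) C₁ e hEC he hC₁reg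
  · -- (c4) the centre is a Cartier divisor on `V(𝓔)`, read on `𝒦₁ = C₁·𝒪_X`
    have h := isEffectiveCartier_transportedCentre_comap ρ 𝓔 (I.comap τ₀) C₁ e he hC₁cart
    rw [Scheme.IdealSheafData.comap_sup, comap_subschemeι_self, bot_sup_eq] at h
    exact h
  · -- (c5) quasi-regular 2-frames (`𝓔` is an effective Cartier divisor: locally principal and non-zero on the integral `X`)
    have h𝓔0 : 𝓔 ≠ ⊥ := by
      intro h0
      have h1 : 𝓔.comap jG = ⊥ := by rw [h0, Scheme.IdealSheafData.comap_bot]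
      rw [he_i] at h1
      have h2 := congrArg (fun J : G.IdealSheafData => (J.support : Set G)) h1
      simp only [Scheme.IdealSheafData.coe_support_vanishingIdeal, Scheme.IdealSheafData.support_bot] at h2
      -- `E = univ` contradicts `¬ T ⊆ E`
      apply hTE
      intro t _
      have ht : t ∈ ((⟨E, hE⟩ : Closeds G) : Set G) := by rw [h2]; trivial
      exact ht
    have hε : IsEffectiveCartier 𝓔 :=
      isEffectiveCartier_of_stalkIdeal_eq_span_singleton fun x _ => by
        obtain ⟨g, hg⟩ := he_ii x
        refine ⟨g, ?_, by rw [hg, Ideal.submodule_span_eq]⟩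
        intro hg0
        apply stalkIdeal_ne_bot_of_ne_bot h𝓔0 x
        rw [hg, Ideal.submodule_span_eq, hg0, Ideal.span_singleton_eq_bot]
    exact exists_twoFrame_transportedCentre ρ 𝓔 (I.comap τ₀) C₁ e he hε hC₁cart
  · -- (c6) rational, through `V(C̃) ≅ V(C₁)` over `ρ`
    obtain ⟨ee, hee⟩ := exists_iso_subscheme_transportedCentre ρ 𝓔 (I.comap τ₀) C₁ e hEC he
    have h := RatCarrier.hCrat_of_iso_over ((τ₀ ≫ σ₀) ≫ q) ρ C₁ (𝓔 ⊔ C₁.comap ρ) ee hee hC₁rat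
    intro hr
    obtain ⟨e₁, he₁⟩ := h hr
    refine ⟨e₁, ?_⟩
    rw [he₁, hσ]; simp only [Category.assoc]

end Summit.ResolutionOfSingularities.ResolutionOfSingularities.Cruxes.EquisingularLiftNat.Sections

end
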